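import Summits.QuantumAdvantage.QuantumAdvantage.Theorems.CubicForrelationNearExactIsExactTwelvePartnerSymplectic
import Summits.QuantumAdvantage.QuantumAdvantage.Theorems.CubicForrelationNearExactIsExactTwelvePartnerRadical

/-!
# Crux `CubicForrelation.NearExactIsExact` (stmt-QuantumAdvantage-14043) — n = 12, E1280-even: the MATRIX CORES of the R2 leaves
  T(a), T(b), s₀ω₄(a), s₀ω₄(b), s₀ω₆, s₀ω₈ and of the R4 leaf "descendant 0, w = 3" (hand proofs replacing g37's exhaustive enumerations)

Certificate seat `b2b-cforr-cert` (gen 39).  HONEST FRAMING: kernel-checked linear algebra over `𝔽₂` (standard axioms).  Each theorem is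
the CORE CONTRADICTION of one leaf of HOME/b2b-cforr-cert-g39/E1280-HANDPROOFS.md §1, stated for the block matrices that the pairing-partner
equations produce in the rank-2 frame `d = y₁y₂y₃ + y₂∧G + y₃∧Γ + t̄` (R2-PARTNER.md §2): `A = ι_{y₂}c`, `B = ι_{y₃}c` on the nine cell
coordinates, the light structure of `(G, Γ)` from the cell lemmas, and the identities (E1)–(E3′) of the hand-proof note.  The derivation
of these block identities from `Σ_{j<k} c_{pjk} d_{φjk} = [p = φ]` (pure bookkeeping) and the frames themselves are NOT formalised here;
so these lemmas exclude nothing about `θ₁₂` yet and are NOT summit progress.  What they replace: R2-PARTNER §5's rows T(a) (8 × 2²¹),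
T(b) (42 106 × 2⁶), s₀ω₈ and s₀ω₆ (4 × 2¹⁶ each), s₀ω₄(a) (43 144 × 2¹⁶, kit j225906), s₀ω₄(b) (400 × 2¹⁶, kit j225675).

* `tpl_R2_Ta_core` — §1.2 (g37 §4b): blocks `(FU) Γ_FF B_UFᵀ = 0`, `(UU) Γ_UF B_UFᵀ = 0`, `(FF) Γ_UFᵀ B_UF + Γ_FF B_FF = 1`,
  `(y₃,y₃) Σ Γ_{uf}B_{uf} + ⟨B_FF, Γ_FF⟩ = 0` ⇒ `False` (symplectic pairing parity `⟨Γ_FF⁻¹, Γ_FF⟩ = 3`).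
* `tpl_R2_Tb_core` / `tpl_R2_w4b_core` — §1.1 / §1.6: `1_k` is not a sum of fewer than `k` outer products (T(b): `k = 6`, at most
  `1 + 2` products; s₀ω₄(b): `k = 4`, two products) — via `tpr_outer_sum_obstruction`.
* `tpl_R2_w6_core` / `tpl_R2_w4a_core` — §1.4 / §1.5: the F′ × F′ block `g αᵀ + γ βᵀ (+ m uᵀ + m′ vᵀ) = 1` makes `α` the dual vector of `g`,
  so `g·α = 1`, while (E1) `⟨G, A⟩ = g·α = 0`.
* `tpl_R2_w8_core` — §1.3: `K = ω + εA + ε′B` with `⟨ω,A⟩ = ⟨ω,B⟩ = 0` and `⟨ω,ω⟩ = 0` (four hyperbolic pairs) contradicts `⟨ω,K⟩ = 1`.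
* `tpl_R4_Z_rank4_core` / `tpl_R4_Z_rank6_core` — §2.4 (iii)/(iv): R4, descendant 0, hyperplane-section case, in the normal form
  `d = y∧ω + v₀∧(Ξ + Σ_t v_t∧y_t)` with `rad Ξ = ⟨e₄,e₅,e₆⟩` resp. `⟨e₆⟩`: dual bases on the radical, resp. a finite bit analysis plus the
  symplectic pairing parity of the `6 × 6` blocks.  [replaces fam_RZ: 30 × 2²¹, kit j226244, and g36's DZ6 SAT leaves]
The R4 leaves x₁q₄ / T-I / T-II and the R2 leaf T⊕T′ are direct instances of `tpr_radical_obstruction` (…TwelvePartnerRadical).  With this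
file every formerly-enumerated leaf of the E1280-even analysis has a kernel-checked algebraic core; what is NOT here: the frames, the (PAIR)
bookkeeping producing these block identities, and the cell lemmas (E1280-HANDPROOFS.md §3, (L3)–(L6)).

References: this work (cert seats g36–g39).  Axioms: the standard three.
-/

set_option linter.dupNamespace false -- D-0017: single-problem summit ⇒ `QuantumAdvantage.QuantumAdvantage` by design

namespace Summit.QuantumAdvantage.QuantumAdvantage.Theorems.CubicForrelation.NearExactIsExact

open Finset Matrix

/-! ### R2, descendant `T`, sub-case (a): the block argument of R2-PARTNER §4b -/

/-- **E1280-even, R2 half, descendant `T` sub-case (a) — the core contradiction** (HOME/b2b-cforr-cert-g37/R2-PARTNER.md §4b,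
E1280-HANDPROOFS.md §1.2).  In the rank-2 frame `d = y₁y₂y₃ + y₂∧G + y₃∧Γ + s₀s₁s₂` with `G ∈ Λ²U*`, the pairing equations for a partner
`c` give, for the blocks of `Γ` and of `B = ι_{y₃}c` with respect to `S = U ⊕ F` (`|U| = 3`, `|F| = 6`): `(FU) Γ_FF B_UFᵀ = 0`,
`(UU) Γ_UF B_UFᵀ = 0`, `(FF) Γ_UFᵀ B_UF + Γ_FF B_FF = 1`, and `(y₃,y₃)` `Σ_{u,f} Γ_{uf}B_{uf} + ⟨B_FF, Γ_FF⟩ = 0` (`B_UU = 0`).  These are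
contradictory: `P = Γ_UFᵀ B_UF` squares to `0`, so `Γ_FF (B_FF (1+P)) = 1`, `Γ_FF` is invertible, `B_UF = 0`, `B_FF Γ_FF = 1`, and the
symplectic pairing parity gives `⟨B_FF, Γ_FF⟩ = 3 = 1`. [this work] -/
theorem tpl_R2_Ta_core (ΓUF BUF : Matrix (Fin 3) (Fin 6) (ZMod 2)) (ΓFF BFF : Matrix (Fin 6) (Fin 6) (ZMod 2))
    (hΓs : ΓFFᵀ = ΓFF) (hΓd : ∀ i, ΓFF i i = 0)
    (hFU : ΓFF * BUFᵀ = 0) (hUU : ΓUF * BUFᵀ = 0) (hFF : ΓUFᵀ * BUF + ΓFF * BFF = 1)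
    (hpair : (∑ u, ∑ f, ΓUF u f * BUF u f) + (∑ i, ∑ j, if i < j then BFF i j * ΓFF i j else 0) = 0) : False := by
  set P : Matrix (Fin 6) (Fin 6) (ZMod 2) := ΓUFᵀ * BUF with hP
  have hPP : P * P = 0 := by
    have h1 : BUF * ΓUFᵀ = 0 := by
      have := congrArg Matrix.transpose hUU
      rwa [Matrix.transpose_mul, Matrix.transpose_transpose, Matrix.transpose_zero] at this
    calc P * P = ΓUFᵀ * (BUF * ΓUFᵀ) * BUF := by rw [hP]; simp only [Matrix.mul_assoc]
      _ = 0 := by rw [h1, Matrix.mul_zero, Matrix.zero_mul]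
  have hΓB : ΓFF * BFF = 1 + P := by
    have h : ΓFF * BFF = 1 - P := eq_sub_of_add_eq' hFF
    rw [h, sub_eq_add_neg]
    congr 1
    ext i j
    simp only [Matrix.neg_apply]
    exact CharTwo.neg_eq _
  -- `Γ_FF` is invertible with inverse `B_FF (1 + P)`
  have h2P : P + P = 0 := by
    ext i j
    simp only [Matrix.add_apply, Matrix.zero_apply]
    exact CharTwo.add_self_eq_zero _
  have hinv : ΓFF * (BFF * (1 + P)) = 1 := by
    rw [← Matrix.mul_assoc, hΓB, Matrix.add_mul, Matrix.one_mul, Matrix.mul_add, Matrix.mul_one, hPP, add_zero, add_assoc,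
      h2P, add_zero]
  have hinv' : (BFF * (1 + P)) * ΓFF = 1 := mul_eq_one_comm.mp hinv
  have hBUF : BUF = 0 := by
    have h : (BFF * (1 + P)) * (ΓFF * BUFᵀ) = 0 := by rw [hFU, Matrix.mul_zero]
    rw [← Matrix.mul_assoc, hinv', Matrix.one_mul] at h
    have := congrArg Matrix.transpose h
    rwa [Matrix.transpose_transpose, Matrix.transpose_zero] at this
  have hP0 : P = 0 := by rw [hP, hBUF, Matrix.mul_zero]
  have hBΓ : BFF * ΓFF = 1 := by
    have h : ΓFF * BFF = 1 := by rw [hΓB, hP0, add_zero]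
    exact mul_eq_one_comm.mp h
  have h3 := tps_pairing_inverse_alternating (n := 6) 3 rfl ΓFF BFF hΓs hΓd hBΓ
  rw [hBUF, h3] at hpair
  revert hpair
  simp only [Matrix.zero_apply, mul_zero, Finset.sum_const_zero, zero_add]
  decide

/-! ### R2, descendants `T`(b) and `s₀ω₄`(b): too few outer products -/

/-- **Core of T(b) (§1.1).**  The F×F block of (E3′) is `G_{F,·}A_{·,F} + Γ_{F,·}B_{·,F} = 1₆`; the light structure makes `G_{F,·} = g νᵀ`
(rank `≤ 1`) and `Γ_{F,·}` a sum of at most two outer products (types (0,0), (0,1): `≤ 1`; type (1,0): columns in `span(m, m′)`), so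
`1₆ = Σ_{i<6} b_i a_iᵀ` with `b_3 = b_4 = b_5 = 0` — impossible. [this work] -/
theorem tpl_R2_Tb_core (b a : Fin 6 → Fin 6 → ZMod 2) (h : ∀ r s, (∑ i, b i r * a i s) = if r = s then 1 else 0)
    (hb : b 5 = 0) : False :=
  tpr_outer_sum_obstruction b a h 5 hb

/-- **Core of s₀ω₄(b) (§1.6).**  With `D, D′` supported on `P × P`, the F′-rows of `G, Γ` are `g e_{s₀}ᵀ, γ e_{s₀}ᵀ`, so the F′×F′ block of
(E3′) is `g αᵀ + γ βᵀ = 1₄` — two outer products: impossible. [this work] -/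
theorem tpl_R2_w4b_core (g γ α β : Fin 4 → ZMod 2) (hblock : ∀ r s, g r * α s + γ r * β s = if r = s then 1 else 0) : False :=
  tpr_outer_sum_obstruction (k := 4) ![g, γ, 0, 0] ![α, β, 0, 0]
    (fun r s => by rw [Fin.sum_univ_four]; simpa using hblock r s) 3 rfl

/-! ### R2, descendants `s₀ω₆` and `s₀ω₄`(a): dual bases -/

/-- **Core of s₀ω₆ (§1.4).**  With `F′ = {s₇, s₈}`: the F′×F′ block of (E3′) reads `g αᵀ + γ βᵀ = 1₂` (`g, γ` the F′-parts of the
`s₀`-rows of `G, Γ`; `α, β` the F′-parts of the `s₀`-rows of `A, B`), while (E1)+(E2) give `⟨G, A⟩ = g·α = 0`.  Contradiction: `α` is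
the dual vector of `g`. [this work] -/
theorem tpl_R2_w6_core (g γ α β : Fin 2 → ZMod 2) (hblock : ∀ r s, g r * α s + γ r * β s = if r = s then 1 else 0)
    (hE1 : (∑ r, g r * α r) = 0) : False := by
  have h := tpr_dual_basis (k := 2) ![g, γ] ![α, β] (fun r s => by
    rw [Fin.sum_univ_two]; simpa using hblock r s) 0 0
  simp only [if_true, Matrix.cons_val_zero] at h
  rw [show (∑ r, α r * g r) = ∑ r, g r * α r from Finset.sum_congr rfl fun r _ => mul_comm _ _, hE1] at h
  exact zero_ne_one h

/-- **Core of s₀ω₄(a) (§1.5).**  With `F′ = {s₅..s₈}` and `Γ_HH = ε′ω₄ + m∧m′`: the F′×F′ block of (E3′) reads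
`g αᵀ + γ βᵀ + m uᵀ + m′ vᵀ = 1₄`, while `⟨G, A⟩ = g·α = 0`.  Contradiction as in §1.4. [this work] -/
theorem tpl_R2_w4a_core (g γ m m' α β u v : Fin 4 → ZMod 2)
    (hblock : ∀ r s, g r * α s + γ r * β s + m r * u s + m' r * v s = if r = s then 1 else 0)
    (hE1 : (∑ r, g r * α r) = 0) : False := by
  have h := tpr_dual_basis (k := 4) ![g, γ, m, m'] ![α, β, u, v] (fun r s => by
    rw [Fin.sum_univ_four]; simpa using hblock r s) 0 0
  simp only [if_true, Matrix.cons_val_zero] at h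
  rw [show (∑ r, α r * g r) = ∑ r, g r * α r from Finset.sum_congr rfl fun r _ => mul_comm _ _, hE1] at h
  exact zero_ne_one h

/-! ### R2, descendant `s₀ω₈`: parity of the number of hyperbolic pairs -/

/-- **Core of s₀ω₈ (§1.3).**  On `H = P` (8 points): `K = ω + εA + ε′B` (the P×P block of (E3)), `⟨ω, A⟩ = ⟨ω, B⟩ = 0` (E2),
`⟨ω, K⟩ = 1` (the `(s₀,s₀)` equation), and `⟨ω, ω⟩ = 0` (`ω = ω₈` has four pairs) are contradictory by bilinearity of the pairing.
[this work] -/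
theorem tpl_R2_w8_core {n : ℕ} (ω A B K : Matrix (Fin n) (Fin n) (ZMod 2)) (ε ε' : ZMod 2)
    (hK : K = ω + ε • A + ε' • B)
    (hωA : (∑ i, ∑ j, (if i < j then ω i j * A i j else 0)) = 0) (hωB : (∑ i, ∑ j, (if i < j then ω i j * B i j else 0)) = 0)
    (hωω : (∑ i, ∑ j, (if i < j then ω i j * ω i j else 0)) = 0) (hωK : (∑ i, ∑ j, (if i < j then ω i j * K i j else 0)) = 1) :
    False := by
  rw [hK] at hωK
  have hsplit : (∑ i, ∑ j, (if i < j then ω i j * (ω + ε • A + ε' • B) i j else 0)) =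
      (∑ i, ∑ j, (if i < j then ω i j * ω i j else 0)) + ε * (∑ i, ∑ j, (if i < j then ω i j * A i j else 0)) +
        ε' * (∑ i, ∑ j, (if i < j then ω i j * B i j else 0)) := by
    rw [Finset.mul_sum, Finset.mul_sum, ← Finset.sum_add_distrib, ← Finset.sum_add_distrib]
    refine Finset.sum_congr rfl fun i _ => ?_
    rw [Finset.mul_sum, Finset.mul_sum, ← Finset.sum_add_distrib, ← Finset.sum_add_distrib]
    refine Finset.sum_congr rfl fun j _ => ?_
    simp only [Matrix.add_apply, Matrix.smul_apply, smul_eq_mul]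
    split_ifs <;> ring
  rw [hsplit, hωω, hωA, hωB] at hωK
  simp at hωK

/-! ### R4, descendant `0`, hyperplane-section case (`w = 3`): the two radical ranks (E1280-HANDPROOFS §2.4 (iii), (iv)) -/

/-- **Core of R4 / descendant 0 / w = 3, `rank Ξ = 4` (§2.4(iii)).**  Normal form `d = y∧ω + v₀∧(Ξ + Σ_t v_t∧y_t)` on `Z = 𝔽₂⁷` with
`rad Ξ = ⟨e₄,e₅,e₆⟩` (columns `4,5,6` of `Ξ` vanish) and `κ_t := (c_{z_j v₀ v_t})_j ∈ rad Ξ`.  The pairing equations give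
`(Z) N Ξ + Σ_t κ_t y_tᵀ = 1`, `(y,y) g₁ + c = 1`, `(v₁,v₁) g₁ + y₁·κ₁ = 1`, `(v₂,v₂) c + y₂·κ₂ = 1` (`g₁ = c_{yv₀v₁}`, `c = c_{yv₂v₃}`);
the radical columns of (Z) make `(y_t|_{rad})` and `(κ_t)` dual bases, so `y₁·κ₁ = y₂·κ₂ = 1`, whence `g₁ = 0`, `c = 1`, `1 + 1 = 1`.
[this work; replaces fam_RZ `*_r4`: 15 × 2²¹] -/
theorem tpl_R4_Z_rank4_core (Ξ N : Matrix (Fin 7) (Fin 7) (ZMod 2)) (y κ : Fin 3 → Fin 7 → ZMod 2) (g₁ c : ZMod 2)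
    (hΞ4 : ∀ i, Ξ i 4 = 0) (hΞ5 : ∀ i, Ξ i 5 = 0) (hΞ6 : ∀ i, Ξ i 6 = 0)
    (hκ : ∀ t, κ t 0 = 0 ∧ κ t 1 = 0 ∧ κ t 2 = 0 ∧ κ t 3 = 0)
    (hZ : ∀ i j, (N * Ξ) i j + (∑ t, κ t i * y t j) = if i = j then 1 else 0)
    (hyy : g₁ + c = 1) (h11 : g₁ + (∑ m, y 0 m * κ 0 m) = 1) (h22 : c + (∑ m, y 1 m * κ 1 m) = 1) : False := by
  -- the radical columns of (Z): `Σ_t κ_t[i] y_t[j] = [i = j]` for `j ∈ {4,5,6}`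
  have hcol : ∀ i j, (∀ k, Ξ k j = 0) → (∑ t, κ t i * y t j) = if i = j then 1 else 0 := by
    intro i j hj
    have h := hZ i j
    have h0 : (N * Ξ) i j = 0 := by
      rw [Matrix.mul_apply]; exact Finset.sum_eq_zero fun k _ => by rw [hj k, mul_zero]
    rwa [h0, zero_add] at h
  -- dual bases on the radical coordinates
  have hdb := tpr_dual_basis (k := 3) (fun t => ![κ t 4, κ t 5, κ t 6]) (fun t => ![y t 4, y t 5, y t 6]) (by
    intro r s
    fin_cases r <;> fin_cases s <;>
      simp only [Matrix.cons_val_zero, Matrix.cons_val_one, Matrix.head_cons, Matrix.cons_val_two, Matrix.tail_cons,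
        Fin.zero_eta, Fin.mk_one, Fin.reduceFinMk, Fin.isValue] <;>
      first
      | simpa using hcol 4 4 hΞ4 | simpa using hcol 4 5 hΞ5 | simpa using hcol 4 6 hΞ6
      | simpa using hcol 5 4 hΞ4 | simpa using hcol 5 5 hΞ5 | simpa using hcol 5 6 hΞ6
      | simpa using hcol 6 4 hΞ4 | simpa using hcol 6 5 hΞ5 | simpa using hcol 6 6 hΞ6)
  -- full dot products reduce to the radical coordinates
  have hdot : ∀ t s, (∑ m, y t m * κ s m) = if t = s then 1 else 0 := by
    intro t s
    have h := hdb t s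
    rw [Fin.sum_univ_three] at h
    simp only [Matrix.cons_val_zero, Matrix.cons_val_one, Matrix.head_cons, Matrix.cons_val_two, Matrix.tail_cons] at h
    rw [Fin.sum_univ_seven, (hκ s).1, (hκ s).2.1, (hκ s).2.2.1, (hκ s).2.2.2]
    simpa using h
  rw [hdot 0 0, if_pos rfl] at h11
  rw [hdot 1 1, if_pos rfl] at h22
  have key : ∀ e0 e1 : ZMod 2, e0 + e1 = 1 → e0 + 1 = 1 → e1 + 1 = 1 → False := by decide
  exact key g₁ c hyy h11 h22

/-- **Core of R4 / descendant 0 / w = 3, `rank Ξ = 6` (§2.4(iv)).**  Same normal form with `rad Ξ = ⟨e₆⟩` (column `6` of `Ξ` vanishes,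
`κ_t = σ_t e₆`).  Besides (Z), (y,y), (v_t,v_t) the pairing equations give `y₁·κ₂ = y₃·κ₂ = y₁·κ₃ = y₂·κ₃ = 0` and
`(v₀,v₀) g₁ + ⟨N, Ξ⟩ + Σ_t y_t·κ_t = 1`.  A finite case analysis on the bits `σ_t, y_t[6]` leaves `κ₁ = e₆, κ₂ = κ₃ = 0, y₁[6] = 1, g₁ = 0`;
then (Z) says `N₆ Ξ₆ = 1₆` for the `6 × 6` blocks, the symplectic pairing parity gives `⟨N, Ξ⟩ = ⟨N₆, Ξ₆⟩ = 3 = 1`, and (v₀,v₀) reads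
`0 + 1 + 1 = 1`. [this work; replaces fam_RZ `*_r6`: 15 × 2²¹, and g36's DZ6 leaves] -/
theorem tpl_R4_Z_rank6_core (Ξ N : Matrix (Fin 7) (Fin 7) (ZMod 2)) (y κ : Fin 3 → Fin 7 → ZMod 2) (g₁ c : ZMod 2)
    (hΞs : ∀ i j, Ξ j i = Ξ i j) (hΞd : ∀ i, Ξ i i = 0) (hΞ6 : ∀ i, Ξ i 6 = 0)
    (hκ : ∀ t (m : Fin 7), m ≠ 6 → κ t m = 0)
    (hZ : ∀ i j, (N * Ξ) i j + (∑ t, κ t i * y t j) = if i = j then 1 else 0)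
    (hyy : g₁ + c = 1) (h11 : g₁ + (∑ m, y 0 m * κ 0 m) = 1) (h22 : c + (∑ m, y 1 m * κ 1 m) = 1)
    (h33 : c + (∑ m, y 2 m * κ 2 m) = 1)
    (h21 : (∑ m, y 0 m * κ 1 m) = 0) (h23 : (∑ m, y 2 m * κ 1 m) = 0)
    (h31 : (∑ m, y 0 m * κ 2 m) = 0) (h32 : (∑ m, y 1 m * κ 2 m) = 0)
    (h00 : g₁ + (∑ i, ∑ j, (if i < j then N i j * Ξ i j else 0)) + (∑ t, ∑ m, y t m * κ t m) = 1) : False := by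
  -- dot products: `y_t · κ_s = y_t[6] σ_s`
  have hdot : ∀ t s, (∑ m, y t m * κ s m) = y t 6 * κ s 6 := by
    intro t s
    rw [Fin.sum_univ_seven, hκ s 0 (by decide), hκ s 1 (by decide), hκ s 2 (by decide), hκ s 3 (by decide), hκ s 4 (by decide),
      hκ s 5 (by decide)]
    ring
  simp only [hdot] at h11 h22 h33 h21 h23 h31 h32 h00
  -- the (6,6) entry of (Z): `Σ_t σ_t y_t[6] = 1`
  have h66 : (∑ t, κ t 6 * y t 6) = 1 := by
    have h := hZ 6 6
    have h0 : (N * Ξ) 6 6 = 0 := by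
      rw [Matrix.mul_apply]; exact Finset.sum_eq_zero fun k _ => by rw [hΞ6 k, mul_zero]
    rwa [h0, zero_add, if_pos rfl] at h
  rw [Fin.sum_univ_three] at h66 h00
  -- finite case analysis on the eight bits `σ_t = κ_t[6]`, `η_t = y_t[6]`, `g₁`, `c`
  have key : ∀ a0 a1 a2 b0 b1 b2 e0 e1 : ZMod 2, a0 * b0 + a1 * b1 + a2 * b2 = 1 → e0 + e1 = 1 → e0 + b0 * a0 = 1 →
      e1 + b1 * a1 = 1 → e1 + b2 * a2 = 1 → b0 * a1 = 0 → b2 * a1 = 0 → b0 * a2 = 0 → b1 * a2 = 0 →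
      (a1 = 0 ∧ a2 = 0 ∧ a0 = 1 ∧ b0 = 1 ∧ e0 = 0 ∧ e1 = 1) := by decide
  have hbits := key _ _ _ _ _ _ _ _ h66 hyy h11 h22 h33 h21 h23 h31 h32
  obtain ⟨hk1, hk2, hk0, hy0, hg, hc⟩ := hbits
  -- `κ₁ = κ₂ = 0`, `κ₀ = e₆`; the 6×6 blocks satisfy `N₆ Ξ₆ = 1`
  have hκ1 : ∀ m, κ 1 m = 0 := by
    intro m
    by_cases hm : m = 6
    · rw [hm, hk1]
    · exact hκ 1 m hm
  have hκ2 : ∀ m, κ 2 m = 0 := by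
    intro m
    by_cases hm : m = 6
    · rw [hm, hk2]
    · exact hκ 2 m hm
  set N6 : Matrix (Fin 6) (Fin 6) (ZMod 2) := Matrix.of fun i j => N (Fin.castSucc i) (Fin.castSucc j) with hN6
  set X6 : Matrix (Fin 6) (Fin 6) (ZMod 2) := Matrix.of fun i j => Ξ (Fin.castSucc i) (Fin.castSucc j) with hX6
  have hlast : (Fin.last 6 : Fin 7) = 6 := rfl
  have hblock : N6 * X6 = 1 := by
    ext i j
    have h := hZ (Fin.castSucc i) (Fin.castSucc j)
    have hne : Fin.castSucc i ≠ (6 : Fin 7) := fun h' => by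
      have := congrArg Fin.val h'; simp at this; omega
    rw [Fin.sum_univ_three, hκ 0 _ hne, hκ1, hκ2, zero_mul, zero_mul, zero_mul, add_zero, add_zero, add_zero] at h
    rw [Matrix.mul_apply, Fin.sum_univ_castSucc, hlast, hΞs, hΞ6, mul_zero, add_zero] at h
    rw [Matrix.mul_apply, Matrix.one_apply]
    simp only [hN6, hX6, Matrix.of_apply]
    simpa [Fin.castSucc_inj] using h
  have hX6s : X6ᵀ = X6 := by ext i j; simp only [hX6, Matrix.transpose_apply, Matrix.of_apply]; exact hΞs _ _
  have hX6d : ∀ i, X6 i i = 0 := fun i => by simp only [hX6, Matrix.of_apply]; exact hΞd _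
  have hpar := tps_pairing_inverse_alternating (n := 6) 3 rfl X6 N6 hX6s hX6d hblock
  -- the 7×7 pairing equals the 6×6 one (row/column 6 of `Ξ` vanish)
  have hpair7 : (∑ i, ∑ j, (if i < j then N i j * Ξ i j else 0)) = ∑ i : Fin 6, ∑ j : Fin 6, (if i < j then N6 i j * X6 i j else 0) := by
    rw [Fin.sum_univ_castSucc, hlast]
    have hrow6 : (∑ j, (if (6 : Fin 7) < j then N 6 j * Ξ 6 j else 0)) = 0 :=
      Finset.sum_eq_zero fun j _ => by rw [hΞs, hΞ6, mul_zero, ite_self]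
    rw [hrow6, add_zero]
    refine Finset.sum_congr rfl fun i _ => ?_
    rw [Fin.sum_univ_castSucc, hlast, hΞ6, mul_zero, ite_self, add_zero]
    refine Finset.sum_congr rfl fun j _ => ?_
    simp only [Fin.castSucc_lt_castSucc_iff, hN6, hX6, Matrix.of_apply]
  rw [hpair7, hpar, hg, hk0, hk1, hk2, hy0] at h00
  simp only [mul_zero, add_zero, mul_one, zero_add] at h00
  revert h00
  decide

end Summit.QuantumAdvantage.QuantumAdvantage.Theorems.CubicForrelation.NearExactIsExact
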